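/-
Origin: expansion seat `planner-pub-hodgecm-pv10-0`, handover 2026-08-18T03:34:14Z (`HOME/pub-hodgecm-pv10/lean/Pv10/UnramifiedFactors.lean`, md5 e113917e, 309 lines);
landed by the gen-5 packager in gate run 19 as `HodgeCM/PerL34/UnramifiedFactors.lean` (verbatim).
-/
/-
Copyright: HodgeCM publication cell, unit pub-hodgecm-pv10 (DAG-NODE PROVER #10).
Origin: pub-hodgecm-pv10/lean/Pv10/UnramifiedFactors.lean — companion to `NoSmallSubgroups.lean`
(node N31g, PerL v5 Lemma 4.2(b) proof, tex ll. 623–631), covering the VALUES half ll. 628–631.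
Suggested package target: `HodgeCM/PerL34/UnramifiedFactors.lean`
(namespace `HodgeCM.PerL34.UnramifiedFactors`).  Imports: `HodgeCM.Prior.Perl34` (⇒ Mathlib).
-/
import Summits.HodgeConjecture.HodgeCM.Prior.Perl34_5

/-!
# N31g, second half — the unramified local values (PerL v5, proof of Lemma 4.2(b), ll. 628–631)

Verbatim tex (ll. 628–631):

> Enlarging $S$, for $v\notin S$ also $\phi_v=\phi^0_v$ and all splitting data are unramified, and
> then $I_v(\phi^0_v)=1$, resp.\ (at split $v$, where $U(W_i)(L_{0,v})\cong L_{0,v}^\times$ acts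
> through the character $\nu_v$ of the splitting and the dilation $|y|^{3/2}$ on the Schrödinger
> model) $I_v(\phi^0_v)=\sum_{n\in\mathbb Z}q_v^{-3|n|/2}a_v^{\,n}=(1-q_v^{-3})\,|1-a_vq_v^{-3/2}|^{-2}$
> with $a_v:=\chi'_{i,v}(\varpi_v)\nu_v(\varpi_v)$, $|a_v|=1$.

## What this file kernel-checks (LABEL: PROVED, Mathlib + the landed Prior C4 algebra only)

* §1 `tParam q = (q·√q)⁻¹ = q^{-3/2}` and its bounds `0 ≤ t ≤ 1/2`, `t < 1`, `t² = q⁻³`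
  (these are exactly the `RallisDatum.tpar_nonneg` / `tpar_le` obligations of
  `HodgeCM.Prior.Perl34File.Perl34.C4.RallisDatum` at a place of residue cardinality `q ≥ 2`);
  `‖χ′(ϖ)·ν(ϖ)‖ = 1` from `‖χ′(ϖ)‖ = ‖ν(ϖ)‖ = 1` (`apar_norm`).
* §2 the closed form in the tex's `q`-notation:
  `Σ_{n∈ℤ} q^{-3|n|/2} aⁿ = (1 − q⁻³) / |1 − a q^{-3/2}|²`, positivity, and the L-factor reading
  `(1 − t²) / ((1 − a t)(1 − ā t))` (value at the unramified data of
  `ζ_v(3)⁻¹·L_v(3/2, a)·L_v(3/2, ā)`-type quotient) — from Prior C4 `hasSum_eulerFactor`.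
* §3 a generic SHELL-INTEGRATION lemma: if `f` agrees with the constant `g i` on the `i`-th piece of
  a countable measurable partition by pieces of measure `1` and `Σ ‖g i‖ < ∞`, then
  `∫ f = Σ g i` (Bochner integral, any complete normed space).
* §4 the split unramified value ASSEMBLED from §2–§3: for a measure space `(Y, μ)` partitioned into
  shells `P n` (`n ∈ ℤ`) of mass `1` and an integrand equal to `t^{|n|} aⁿ` on `P n`,
  `∫_Y F dμ = Σ_{n∈ℤ} t^{|n|} aⁿ = (1 − q⁻³)/|1 − a q^{-3/2}|²` — i.e. the tex's displayed chain,
  with `Y = U(W_i)(L_{0,v}) ≅ L_{0,v}^×`, `P n = ϖⁿ𝒪_v^×`, `vol(𝒪_v^×) = 1`.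
* §5 the non-split unramified value: on a probability space an integrand identically `1`
  integrates to `1` (`Y = U(W_i)(L_{0,v}) = U(1)(𝒪_v)` compact of volume `1`).

## What is NOT proved here and is carried as explicit hypotheses (LABEL: INTERNAL / vocabulary D4)

The identification of the INTEGRAND with the shell values — i.e. the Schrödinger-model formula
`⟨ω_v(y)φ⁰_v, φ⁰_v⟩ = ν_v(y)·q_v^{-3·|ord y|/2}` for `y ∈ ϖⁿ𝒪^×` at a split unramified place, and
`⟨ω_v(k)φ⁰_v, φ⁰_v⟩ = ‖φ⁰_v‖² = 1` for `k` in the hyperspecial stabiliser of the self-dual lattice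
(unramified Weil representation; [MVW] = Moeglin–Vignéras–Waldspurger, LNM 1291, ch. 5;
[Li92] §5 "the unramified computation", pp. 205–207) — requires the local Weil representation
(LEMMAS.md §3 defs-needed D4), absent from the package.  These enter §4/§5 ONLY as the hypotheses
`hF` / `hcoeff`; see GAPS.md (pub-hodgecm-pv10, node N31g, sub-step ll. 629–631).
The triviality `χ′_v ≡ 1` on `U(1)(𝒪_v)` for almost all `v` used in §5 IS kernel-proved, in
`NoSmallSubgroups.lean` (`RestrictedProduct.continuousChar_trivial_on_almost_all`).

No new axioms; every theorem closes over `[propext, Classical.choice, Quot.sound]`.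
-/

set_option autoImplicit false

noncomputable section

open MeasureTheory Set Filter Function
open scoped BigOperators Topology

namespace HodgeCM.PerL34.UnramifiedFactors

open HodgeCM.Prior.Perl34File.Perl34

/-! ## §1  The parameters `t_v = q_v^{-3/2}` and `a_v = χ′_v(ϖ_v) ν_v(ϖ_v)` -/

/-- `t_v := q_v^{-3/2}`, written `rpow`-free as `(q · √q)⁻¹` (tex l. 630: the exponent `q_v^{-3|n|/2}`
is `t_v^{|n|}`). -/
def tParam (q : ℕ) : ℝ := ((q : ℝ) * Real.sqrt q)⁻¹

/-- (Ported verbatim from the HodgeCMPerL package; no docstring in the source.) -/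
theorem tParam_nonneg (q : ℕ) : 0 ≤ tParam q := by
  unfold tParam
  exact inv_nonneg.mpr (by positivity)

/-- (Ported verbatim from the HodgeCMPerL package; no docstring in the source.) -/
theorem tParam_pos {q : ℕ} (hq : 0 < q) : 0 < tParam q := by
  unfold tParam
  have hq' : (0 : ℝ) < q := by exact_mod_cast hq
  exact inv_pos.mpr (mul_pos hq' (Real.sqrt_pos.mpr hq'))

/-- `t_v = q_v^{-3/2}` literally, as a real power. -/
theorem tParam_eq_rpow {q : ℕ} (hq : 0 < q) : tParam q = (q : ℝ) ^ (-(3 / 2 : ℝ)) := by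
  have hq' : (0 : ℝ) < q := by exact_mod_cast hq
  unfold tParam
  rw [Real.rpow_neg hq'.le, Real.sqrt_eq_rpow,
    show (3 / 2 : ℝ) = 1 + 1 / 2 by norm_num, Real.rpow_add hq', Real.rpow_one]

/-- `t_v² = q_v⁻³` (so `1 − t_v² = 1 − q_v⁻³`, the numerator of l. 630). -/
theorem tParam_sq (q : ℕ) : tParam q ^ 2 = ((q : ℝ) ^ 3)⁻¹ := by
  unfold tParam
  have hq : (0 : ℝ) ≤ q := by positivity
  rw [inv_pow, mul_pow, Real.sq_sqrt hq]
  ring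

/-- `t_v ≤ 2^{-3/2} ≤ 1/2` as soon as `q_v ≥ 2` — the `RallisDatum.tpar_le` obligation. -/
theorem tParam_le_half {q : ℕ} (hq : 2 ≤ q) : tParam q ≤ 1 / 2 := by
  have hq' : (2 : ℝ) ≤ q := by exact_mod_cast hq
  have hsqrt : (1 : ℝ) ≤ Real.sqrt q := by
    rw [show (1 : ℝ) = Real.sqrt 1 by simp]
    exact Real.sqrt_le_sqrt (by linarith)
  have hprod : (2 : ℝ) ≤ (q : ℝ) * Real.sqrt q := by nlinarith
  unfold tParam
  rw [one_div]
  exact inv_anti₀ (by norm_num) hprod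

/-- (Ported verbatim from the HodgeCMPerL package; no docstring in the source.) -/
theorem tParam_lt_one {q : ℕ} (hq : 2 ≤ q) : tParam q < 1 :=
  (tParam_le_half hq).trans_lt (by norm_num)

/-- `|a_v| = 1` for `a_v = χ′_v(ϖ_v)·ν_v(ϖ_v)` with both factors unitary (l. 631) — the
`RallisDatum.apar_norm` obligation. -/
theorem norm_mul_eq_one {c n : ℂ} (hc : ‖c‖ = 1) (hn : ‖n‖ = 1) : ‖c * n‖ = 1 := by
  rw [norm_mul, hc, hn, one_mul]

/-- The general term `q_v^{-3|n|/2} a_vⁿ` has norm `t_v^{|n|}`. -/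
theorem norm_term (t : ℝ) (ht : 0 ≤ t) {a : ℂ} (ha : ‖a‖ = 1) (n : ℤ) :
    ‖(t : ℂ) ^ n.natAbs * a ^ n‖ = t ^ n.natAbs := by
  rw [norm_mul, norm_pow, norm_zpow, ha, one_zpow, mul_one, Complex.norm_real, Real.norm_eq_abs,
    abs_of_nonneg ht]

/-! ## §2  The closed form in `q`-notation and as an L-factor quotient -/

/-- The denominator-free reading of Prior C4's `eulerFactor`:
`(1 − t²)/|1 − a t|² = (1 − t²)/((1 − a t)(1 − ā t))` in `ℂ` (no hypothesis on `a`, `t`). -/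
theorem eulerFactor_eq_Lquotient (t : ℝ) (a : ℂ) :
    ((C4.eulerFactor t a : ℝ) : ℂ) =
      (1 - (t : ℂ) ^ 2) / ((1 - a * t) * (1 - (starRingEnd ℂ) a * t)) := by
  have hconj : (starRingEnd ℂ) ((1 : ℂ) - a * t) = 1 - (starRingEnd ℂ) a * t := by
    simp [map_sub, map_mul, Complex.conj_ofReal]
  rw [← hconj, Complex.mul_conj]
  unfold C4.eulerFactor
  push_cast
  rfl

/-- `eulerFactor` at `t = q^{-3/2}` is the tex's `(1 − q⁻³)·|1 − a q^{-3/2}|⁻²` (l. 630). -/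
theorem eulerFactor_tParam (q : ℕ) (a : ℂ) :
    C4.eulerFactor (tParam q) a = (1 - ((q : ℝ) ^ 3)⁻¹) / Complex.normSq (1 - a * tParam q) := by
  unfold C4.eulerFactor
  rw [tParam_sq]

/-- **l. 630–631, the series identity in `q`-notation**: for `q ≥ 2` and `|a| = 1`,
`Σ_{n∈ℤ} q^{-3|n|/2} aⁿ` converges (as a `HasSum` over `ℤ`) to `(1 − q⁻³)/|1 − a q^{-3/2}|²`. -/
theorem hasSum_unramifiedSplit {q : ℕ} (hq : 2 ≤ q) {a : ℂ} (ha : ‖a‖ = 1) :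
    HasSum (fun n : ℤ => (tParam q : ℂ) ^ n.natAbs * a ^ n)
      (((1 - ((q : ℝ) ^ 3)⁻¹) / Complex.normSq (1 - a * tParam q) : ℝ) : ℂ) := by
  rw [← eulerFactor_tParam]
  exact C4.hasSum_eulerFactor (tParam_nonneg q) (tParam_lt_one hq) ha

/-- (Ported verbatim from the HodgeCMPerL package; no docstring in the source.) -/
theorem tsum_unramifiedSplit {q : ℕ} (hq : 2 ≤ q) {a : ℂ} (ha : ‖a‖ = 1) :
    ∑' n : ℤ, (tParam q : ℂ) ^ n.natAbs * a ^ n =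
      (((1 - ((q : ℝ) ^ 3)⁻¹) / Complex.normSq (1 - a * tParam q) : ℝ) : ℂ) :=
  (hasSum_unramifiedSplit hq ha).tsum_eq

/-- The split unramified factor is a POSITIVE real number (feeds the Euler product, N31h). -/
theorem unramifiedSplit_pos {q : ℕ} (hq : 2 ≤ q) {a : ℂ} (ha : ‖a‖ = 1) :
    0 < (1 - ((q : ℝ) ^ 3)⁻¹) / Complex.normSq (1 - a * tParam q) := by
  rw [← eulerFactor_tParam]
  exact C4.eulerFactor_pos (tParam_nonneg q) (tParam_lt_one hq) ha

/-- The terms are absolutely summable: `Σ_{n∈ℤ} t^{|n|} < ∞` for `0 ≤ t < 1`. -/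
theorem summable_norm_term {t : ℝ} (ht0 : 0 ≤ t) (ht1 : t < 1) {a : ℂ} (ha : ‖a‖ = 1) :
    Summable fun n : ℤ => ‖(t : ℂ) ^ n.natAbs * a ^ n‖ := by
  have h1 : HasSum (fun n : ℤ => (t : ℂ) ^ n.natAbs * (1 : ℂ) ^ n) _ :=
    C4.hasSum_eulerFactor ht0 ht1 (a := 1) (by simp)
  have h2 : Summable fun n : ℤ => ((t ^ n.natAbs : ℝ) : ℂ) := by
    refine h1.summable.congr fun n => ?_
    push_cast
    simp
  have h3 : Summable fun n : ℤ => t ^ n.natAbs := Complex.summable_ofReal.mp h2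
  exact h3.congr fun n => (norm_term t ht0 ha n).symm

/-! ## §3  Shell integration: a piecewise-constant integrand on a countable partition -/

section Shell

variable {X : Type*} [MeasurableSpace X] {μ : Measure X}
variable {E : Type*} [NormedAddCommGroup E] [NormedSpace ℝ E] [CompleteSpace E]
variable {ι : Type*} [Countable ι]

/-- If `f = g i` on the piece `s i` of a countable family of pairwise disjoint measurable sets of
measure `1`, and `Σ ‖g i‖ < ∞`, then `∫_{⋃ s i} f dμ = Σ_i g i` (as a `HasSum`). -/
theorem hasSum_setIntegral_iUnion_of_eqOn {s : ι → Set X} (hm : ∀ i, MeasurableSet (s i))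
    (hd : Pairwise (Disjoint on s)) (hvol : ∀ i, μ (s i) = 1) {f : X → E} {g : ι → E}
    (hfg : ∀ i, EqOn f (fun _ => g i) (s i)) (hg : Summable fun i => ‖g i‖) :
    HasSum g (∫ x in ⋃ i, s i, f x ∂μ) := by
  -- each piece: `f` is the constant `g i` on `s i`, a set of finite measure
  have hpiece : ∀ i, IntegrableOn f (s i) μ := fun i =>
    (integrableOn_const (C := g i) (by rw [hvol i]; exact ENNReal.one_ne_top)).congr_fun
      (hfg i).symm (hm i)
  have hval : ∀ i, ∫ x in s i, f x ∂μ = g i := fun i => by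
    rw [setIntegral_congr_fun (hm i) (hfg i), setIntegral_const, Measure.real, hvol i]
    simp
  have hnorm : ∀ i, ∫ x in s i, ‖f x‖ ∂μ = ‖g i‖ := fun i => by
    have hfg' : EqOn (fun x => ‖f x‖) (fun _ => ‖g i‖) (s i) := fun x hx => by
      simp only [hfg i hx]
    rw [setIntegral_congr_fun (hm i) hfg', setIntegral_const, Measure.real, hvol i]
    simp
  have hint : IntegrableOn f (⋃ i, s i) μ :=
    integrableOn_iUnion_of_summable_integral_norm hpiece (hg.congr fun i => (hnorm i).symm)
  have := hasSum_integral_iUnion hm hd hint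
  simpa only [hval] using this

/-- Same, for a partition of the whole space: `∫ f dμ = Σ_i g i`. -/
theorem hasSum_integral_of_eqOn_partition {s : ι → Set X} (hm : ∀ i, MeasurableSet (s i))
    (hd : Pairwise (Disjoint on s)) (hcover : (⋃ i, s i) = univ) (hvol : ∀ i, μ (s i) = 1)
    {f : X → E} {g : ι → E} (hfg : ∀ i, EqOn f (fun _ => g i) (s i))
    (hg : Summable fun i => ‖g i‖) : HasSum g (∫ x, f x ∂μ) := by
  have h := hasSum_setIntegral_iUnion_of_eqOn hm hd hvol hfg hg
  rwa [hcover, Measure.restrict_univ] at h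

/-- (Ported verbatim from the HodgeCMPerL package; no docstring in the source.) -/
theorem integral_eq_tsum_of_eqOn_partition {s : ι → Set X} (hm : ∀ i, MeasurableSet (s i))
    (hd : Pairwise (Disjoint on s)) (hcover : (⋃ i, s i) = univ) (hvol : ∀ i, μ (s i) = 1)
    {f : X → E} {g : ι → E} (hfg : ∀ i, EqOn f (fun _ => g i) (s i))
    (hg : Summable fun i => ‖g i‖) : ∫ x, f x ∂μ = ∑' i, g i :=
  ((hasSum_integral_of_eqOn_partition hm hd hcover hvol hfg hg).tsum_eq).symm

end Shell

/-! ## §4  The split unramified value (l. 629–631), assembled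

`Y` stands for `U(W_i)(L_{0,v}) ≅ L_{0,v}^×` with its Haar measure `μ` normalised by
`vol(𝒪_v^×) = 1`; `P n` for the shell `ϖ_vⁿ 𝒪_v^×` (`n = ord y`); `F` for the integrand
`y ↦ ⟨ω_v(y)φ⁰_v, φ⁰_v⟩·χ′_{i,v}(y)` of `I_v(φ⁰_v)`.  The hypothesis `hF` is the tex's parenthesis
"acts through the character `ν_v` of the splitting and the dilation `|y|^{3/2}` on the Schrödinger
model" made explicit: on the shell `ord y = n` the integrand is the constant
`q_v^{-3|n|/2}·(χ′_{i,v}ν_v)(ϖ_v)ⁿ = t^{|n|} aⁿ` (`χ′_{i,v}`, `ν_v` unramified).  It is an INPUT here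
(vocabulary D4 — the local Weil representation — is not in the package). -/

section Split

variable {Y : Type*} [MeasurableSpace Y] (μ : Measure Y)

/-- **Split unramified local factor.**  Under the shell hypotheses,
`I_v(φ⁰_v) = ∫_Y F dμ = Σ_{n∈ℤ} q^{-3|n|/2} aⁿ` (first equality of l. 630). -/
theorem split_integral_eq_tsum (P : ℤ → Set Y) (hm : ∀ n, MeasurableSet (P n))
    (hd : Pairwise (Disjoint on P)) (hcover : (⋃ n, P n) = univ) (hvol : ∀ n, μ (P n) = 1)
    {q : ℕ} (hq : 2 ≤ q) {a : ℂ} (ha : ‖a‖ = 1) (F : Y → ℂ)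
    (hF : ∀ n : ℤ, EqOn F (fun _ => (tParam q : ℂ) ^ n.natAbs * a ^ n) (P n)) :
    ∫ y, F y ∂μ = ∑' n : ℤ, (tParam q : ℂ) ^ n.natAbs * a ^ n :=
  integral_eq_tsum_of_eqOn_partition hm hd hcover hvol hF
    (summable_norm_term (tParam_nonneg q) (tParam_lt_one hq) ha)

/-- **Split unramified local factor, closed form** (l. 630 in full):
`I_v(φ⁰_v) = (1 − q_v⁻³)·|1 − a_v q_v^{-3/2}|⁻²`. -/
theorem split_integral_eq_closedForm (P : ℤ → Set Y) (hm : ∀ n, MeasurableSet (P n))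
    (hd : Pairwise (Disjoint on P)) (hcover : (⋃ n, P n) = univ) (hvol : ∀ n, μ (P n) = 1)
    {q : ℕ} (hq : 2 ≤ q) {a : ℂ} (ha : ‖a‖ = 1) (F : Y → ℂ)
    (hF : ∀ n : ℤ, EqOn F (fun _ => (tParam q : ℂ) ^ n.natAbs * a ^ n) (P n)) :
    ∫ y, F y ∂μ = (((1 - ((q : ℝ) ^ 3)⁻¹) / Complex.normSq (1 - a * tParam q) : ℝ) : ℂ) := by
  rw [split_integral_eq_tsum μ P hm hd hcover hvol hq ha F hF, tsum_unramifiedSplit hq ha]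

/-- … and in particular `I_v(φ⁰_v)` is real and `> 0` (what the Euler product N31h consumes). -/
theorem split_integral_re_pos (P : ℤ → Set Y) (hm : ∀ n, MeasurableSet (P n))
    (hd : Pairwise (Disjoint on P)) (hcover : (⋃ n, P n) = univ) (hvol : ∀ n, μ (P n) = 1)
    {q : ℕ} (hq : 2 ≤ q) {a : ℂ} (ha : ‖a‖ = 1) (F : Y → ℂ)
    (hF : ∀ n : ℤ, EqOn F (fun _ => (tParam q : ℂ) ^ n.natAbs * a ^ n) (P n)) :
    0 < (∫ y, F y ∂μ).re ∧ (∫ y, F y ∂μ).im = 0 := by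
  rw [split_integral_eq_closedForm μ P hm hd hcover hvol hq ha F hF, Complex.ofReal_re,
    Complex.ofReal_im]
  exact ⟨unramifiedSplit_pos hq ha, rfl⟩

/-- The `RallisDatum` shape: with `Iloc v := (∫ F).re`, `tpar v := tParam q_v`, `apar v := a_v`,
the field `AX7_split_val` reads `(Iloc v : ℂ) = Σ' n, (tpar v : ℂ)^{|n|} · (apar v)^n`. -/
theorem split_AX7_shape (P : ℤ → Set Y) (hm : ∀ n, MeasurableSet (P n))
    (hd : Pairwise (Disjoint on P)) (hcover : (⋃ n, P n) = univ) (hvol : ∀ n, μ (P n) = 1)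
    {q : ℕ} (hq : 2 ≤ q) {a : ℂ} (ha : ‖a‖ = 1) (F : Y → ℂ)
    (hF : ∀ n : ℤ, EqOn F (fun _ => (tParam q : ℂ) ^ n.natAbs * a ^ n) (P n)) :
    (((∫ y, F y ∂μ).re : ℝ) : ℂ) = ∑' n : ℤ, (tParam q : ℂ) ^ n.natAbs * a ^ n := by
  rw [← split_integral_eq_tsum μ P hm hd hcover hvol hq ha F hF]
  exact Complex.ext (by simp) (by simp [(split_integral_re_pos μ P hm hd hcover hvol hq ha F hF).2])

end Split

/-! ## §5  The non-split unramified value (l. 629: `I_v(φ⁰_v) = 1`)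

`Y = U(W_i)(L_{0,v}) = L_w^1 = U(1)(𝒪_v)` is compact; `μ` is its Haar probability measure.  The two
inputs: `hcoeff` — `⟨ω_v(k)φ⁰_v, φ⁰_v⟩ = 1` (φ⁰_v fixed by the hyperspecial stabiliser, `‖φ⁰_v‖ = 1`;
vocabulary D4, INPUT) and `hχ` — `χ′_{i,v} ≡ 1` on `U(1)(𝒪_v)` (PROVED for almost all `v` in
`NoSmallSubgroups.lean`, ll. 623–629). -/

section NonSplit

variable {Y : Type*} [MeasurableSpace Y] (μ : Measure Y) [IsProbabilityMeasure μ]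

/-- **Non-split unramified local factor**: `I_v(φ⁰_v) = ∫_Y ⟨ω_v(k)φ⁰_v,φ⁰_v⟩ χ′_v(k) dμ(k) = 1`. -/
theorem nonsplit_integral_eq_one (coeff χ : Y → ℂ) (hcoeff : ∀ y, coeff y = 1)
    (hχ : ∀ y, χ y = 1) : ∫ y, coeff y * χ y ∂μ = 1 := by
  have h : (fun y => coeff y * χ y) = fun _ => (1 : ℂ) := funext fun y => by
    rw [hcoeff y, hχ y, one_mul]
  rw [h, integral_const]
  simp

/-- Variant with the character trivial only on a full-measure subgroup-set `K` carrying `μ`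
(stated with `∀ y ∈ K` hypotheses and `μ Kᶜ = 0`). -/
theorem nonsplit_integral_eq_one_ae (K : Set Y) (hK : μ Kᶜ = 0) (coeff χ : Y → ℂ)
    (hcoeff : ∀ y ∈ K, coeff y = 1) (hχ : ∀ y ∈ K, χ y = 1) :
    ∫ y, coeff y * χ y ∂μ = 1 := by
  have hae : (fun y => coeff y * χ y) =ᵐ[μ] fun _ => (1 : ℂ) := by
    have hKae : ∀ᵐ y ∂μ, y ∈ K := mem_ae_iff.mpr hK
    filter_upwards [hKae] with y hy
    rw [hcoeff y hy, hχ y hy, one_mul]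
  rw [integral_congr_ae hae, integral_const]
  simp

end NonSplit

end HodgeCM.PerL34.UnramifiedFactors

end
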